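import Mathlib
import HarnessLib

/-!
# Venture HSemireg — the three-level longitudinal tangency law (TAN-s)₃: the core identity

HONEST FRAMING. Lean leaf for the computation cell `pub-hsemireg` (target seat t-5 gen 19; file of record
`run/shared/lean/pub/pub-hsemireg/target-g6/W3-QLAW-t5g19.md` §7.2′). Setting as in `FibreTestW3QOperator`: a
reduced-point complex with THREE consecutive cohomology sheaves `M₀ → M₁ → M₂` glued by the odd pencil `u`, a generic
pencil element `x = u(s)`, a closed W-class with longitudinal component `B = B(s)` and potentials `V_t, V_r, y = V(s)`,
the curvatures `S_a = {u_a, x}`, the orbit-lemma gauge elements `η_a` (`S_a = η_a x² - x² η_a`), and the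
longitudinal defect `D = xB - Bx`, for which th-3's defect formula (TH3-SIGMA-ORBIT-PROOF §7.2, a consequence of
(E1)∧(E2)) reads `3D = [S_r,V_t] - [S_t,V_r]`.

THIS FILE kernel-checks the ring identity at the heart of t-5 g19's THEOREM (TAN-s)₃ («at three levels, for a closed
class and a generic direction, u(s)·B(s) is tangent to the orbit of u(s)»): on a vector `w` of the bottom piece with
`x²w = 0` (encoded by a right factor `e` with `x x e = 0`), `3·xBx·w = -x²(η_t y u_r - η_r y u_t)·w`, so that
`x·B·x` maps `ker x² ∩ M₀` into `x²M₀` — equivalently `B|_{M₁}` maps `im x ∩ ker x` into `im x + ker x`, which is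
what every conormal vector sees (W3-QLAW §7.2). The three-level hypotheses enter as the vanishing of the words that
would leave the three pieces: `S_a x e = 0` (they land in `M₃ = 0`) and `x x u_a e = 0`; the first-order Killing
relations at the bottom piece enter as `V_a x e = -(y u_a e)`; conormality of `y` as `x y = -(y x)`.
Nothing here constructs an object or bears on HC, HC_CM or HC_AV; the hypotheses are taken as stated and their
derivation from (E1)∧(E2) (the defect formula) is th-3's pencil theorem, not re-proved here.
-/

namespace Summit.Ventures.HSemireg

/-- **Core identity of (TAN-s)₃** (t-5 g19, W3-QLAW §7.2′; any ring). With `D = xB - Bx`,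
`3D = (S_r V_t - V_t S_r) - (S_t V_r - V_r S_t)` (defect formula), `S_a = η_a x x - x x η_a` (orbit lemma),
`x y = -(y x)` (conormal potential), and a right factor `e` with `x x e = 0`, `S_t x e = S_r x e = 0`,
`x x u_t e = x x u_r e = 0` (three levels) and `V_a x e = -(y u_a e)` (first-order Killing relations on the bottom
piece): `3·(x B x e) = -(x x (η_t y u_r - η_r y u_t) e)` — the left side is what the conormal vectors pair with, the
right side is manifestly in the image of `x²`. [folklore] -/
theorem tanS_threeLevel_core {R : Type*} [Ring R]
    (x B D St Sr Vt Vr ηt ηr y ut ur e : R)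
    (hD : D = x * B - B * x)
    (hDF : D + D + D = (Sr * Vt - Vt * Sr) - (St * Vr - Vr * St))
    (hSt : St = ηt * (x * x) - (x * x) * ηt) (hSr : Sr = ηr * (x * x) - (x * x) * ηr)
    (hxy : x * y = -(y * x))
    (hx2e : x * x * e = 0) (hSte : St * x * e = 0) (hSre : Sr * x * e = 0)
    (hute : x * x * ut * e = 0) (hure : x * x * ur * e = 0)
    (hVt : Vt * x * e = -(y * ut * e)) (hVr : Vr * x * e = -(y * ur * e)) :
    x * B * x * e + x * B * x * e + x * B * x * e = -(x * x * ((ηt * y * ur - ηr * y * ut) * e)) := by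
  -- step 1: x B x e = D x e
  have h1 : x * B * x * e = D * x * e := by
    have : x * B = B * x + D := by rw [hD]; abel
    calc x * B * x * e = (B * x + D) * x * e := by rw [this]
      _ = B * (x * x * e) + D * x * e := by noncomm_ring
      _ = D * x * e := by rw [hx2e]; noncomm_ring
  -- step 2: 3 D x e via the defect formula and the three-level / Killing hypotheses
  have h2 : (D + D + D) * x * e = St * (y * ur * e) - Sr * (y * ut * e) := by
    rw [hDF]
    have eS : ((Sr * Vt - Vt * Sr) - (St * Vr - Vr * St)) * x * e
        = Sr * (Vt * x * e) - Vt * (Sr * x * e) - St * (Vr * x * e) + Vr * (St * x * e) := by noncomm_ring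
    rw [eS, hVt, hVr, hSte, hSre]
    noncomm_ring
  -- step 3: S_t (y u_r e) = -x x η_t y u_r e  (x x y = y x x and x x u_r e = 0), same for r
  have hxxy : x * x * y = y * (x * x) := by
    calc x * x * y = x * (x * y) := by noncomm_ring
      _ = x * (-(y * x)) := by rw [hxy]
      _ = -((x * y) * x) := by noncomm_ring
      _ = -((-(y * x)) * x) := by rw [hxy]
      _ = y * (x * x) := by noncomm_ring
  have h3t : St * (y * ur * e) = -(x * x * (ηt * y * ur * e)) := by
    rw [hSt]
    calc (ηt * (x * x) - (x * x) * ηt) * (y * ur * e)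
        = ηt * ((x * x * y) * ur * e) - x * x * (ηt * y * ur * e) := by noncomm_ring
      _ = ηt * ((y * (x * x)) * ur * e) - x * x * (ηt * y * ur * e) := by rw [hxxy]
      _ = ηt * y * (x * x * ur * e) - x * x * (ηt * y * ur * e) := by noncomm_ring
      _ = -(x * x * (ηt * y * ur * e)) := by rw [hure]; noncomm_ring
  have h3r : Sr * (y * ut * e) = -(x * x * (ηr * y * ut * e)) := by
    rw [hSr]
    calc (ηr * (x * x) - (x * x) * ηr) * (y * ut * e)
        = ηr * ((x * x * y) * ut * e) - x * x * (ηr * y * ut * e) := by noncomm_ring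
      _ = ηr * ((y * (x * x)) * ut * e) - x * x * (ηr * y * ut * e) := by rw [hxxy]
      _ = ηr * y * (x * x * ut * e) - x * x * (ηr * y * ut * e) := by noncomm_ring
      _ = -(x * x * (ηr * y * ut * e)) := by rw [hute]; noncomm_ring
  -- assemble
  have h4 : x * B * x * e + x * B * x * e + x * B * x * e = (D + D + D) * x * e := by rw [h1]; noncomm_ring
  rw [h4, h2, h3t, h3r]
  noncomm_ring

end Summit.Ventures.HSemireg
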